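import Literature.Geometry.Symplectic.JHolomorphicMap
import Mathlib.Geometry.Manifold.MFDeriv.Atlas
import Mathlib.Geometry.Manifold.ContMDiff.Atlas
import Mathlib.Geometry.Manifold.ContMDiff.NormedSpace
import Mathlib.Geometry.Manifold.ContMDiffMFDeriv
import Mathlib.Geometry.Manifold.VectorBundle.Tangent
import Mathlib.Analysis.Complex.Basic
import HarnessLib

/-!
# Chart localisation of `J`-holomorphic curves: from the chart back to the manifold

Companion of `Literature/Geometry/Symplectic/JHolomorphicChartLocalization.lean`, which passes
FROM a `J`-holomorphic curve `u : ℂ → M` TO the flat holomorphy of its chart expression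
(`jHolomorphic_fderiv_chart`, dimension four). This file records the CONVERSE direction and the
transfer of smoothness, for an arbitrary `C^∞` manifold `M` (corners allowed) modelled on
`I : ModelWithCorners ℝ E H`:

* `mfderivWithin_extChartAt_symm_apply_mfderiv_extChartAt`, `mfderiv_extChartAt_injective` —
  `B (A v) = v` and injectivity of `A = mfderiv (extChartAt I x₀) x` for `x` in the chart domain,
  `B = mfderivWithin (range I) (extChartAt I x₀).symm (extChartAt I x₀ x)`
  (`mfderivWithin_extChartAt_symm_comp_mfderiv_extChartAt'`);
* `fderiv_extChartAt_comp_apply` — chain rule `D(extChartAt I x₀ ∘ u)(z) = A ∘ du(z)` for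
  `u : ℂ → M` of class `C^n` (`n ≠ 0`) at `z`;
* `inTangentCoordinates_id_apply` — the frame expression `Jin x = A ∘ J x ∘ B` of an endomorphism
  field (`inTangentCoordinates_eq_mfderiv_comp`);
* `jHolomorphic_of_fderiv_chart` — if `D(extChartAt I x₀ ∘ u)(z)(iζ) = Jin (u z) (D(extChartAt I x₀ ∘ u)(z) ζ)`
  for all `ζ`, then `du(z)(iζ) = J (u z) (du(z) ζ)` for all `ζ` (apply the injective `A`);
* `contMDiffAt_of_extChartAt_comp` — `u` is `C^∞` at `z` as soon as it is continuous at `z`,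
  `u z` lies in the chart domain of `x₀` and `extChartAt I x₀ ∘ u` is `C^∞` at `z`
  (`contMDiffAt_iff_target_of_mem_source`).

These are the Literature-side forms of the summit-side helper stubs `helper_jHolomorphic_of_chart`,
`helper_contMDiffAt_of_chart` of
`Summits/SmoothPoincare4/SmoothPoincare4/Theorems/SullivanDualWitnessChargeHelperJHolomorphicChart.lean`
(there for `I = 𝓡 4`; Literature may not import `Summits`), requested for the Literature-side
discharges of the McDuff local facts of `JHolomorphicLocalIntersections.lean` (promote events
3685256, 3685336). Folklore chart calculus; no definitions, no named facts.
-/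

noncomputable section

open scoped Manifold ContDiff Topology
open Set Function

namespace Literature.Geometry.Symplectic

variable {E : Type*} [NormedAddCommGroup E] [NormedSpace ℝ E] {H : Type*} [TopologicalSpace H]
  {I : ModelWithCorners ℝ E H} {M : Type*} [TopologicalSpace M] [ChartedSpace H M]
  [IsManifold I ∞ M]

/-! ### Chart calculus at a point of a chart domain -/

/-- `B (A v) = v` for `A = mfderiv (extChartAt I x₀) x`,
`B = mfderivWithin (range I) (extChartAt I x₀).symm (extChartAt I x₀ x)` and `x` in the chart
domain of `x₀` (`mfderivWithin_extChartAt_symm_comp_mfderiv_extChartAt'`). [folklore] -/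
theorem mfderivWithin_extChartAt_symm_apply_mfderiv_extChartAt {x₀ x : M}
    (hx : x ∈ (chartAt H x₀).source) (v : TangentSpace I x) :
    mfderivWithin 𝓘(ℝ, E) I (extChartAt I x₀).symm (range I) (extChartAt I x₀ x)
      (mfderiv I 𝓘(ℝ, E) (extChartAt I x₀) x v) = v := by
  have hx' : x ∈ (extChartAt I x₀).source := by rwa [extChartAt_source]
  exact DFunLike.congr_fun (mfderivWithin_extChartAt_symm_comp_mfderiv_extChartAt' hx') v

/-- `A = mfderiv (extChartAt I x₀) x` is injective for `x` in the chart domain of `x₀` (it has the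
left inverse `B`). [folklore] -/
theorem mfderiv_extChartAt_injective {x₀ x : M} (hx : x ∈ (chartAt H x₀).source) :
    Injective (mfderiv I 𝓘(ℝ, E) (extChartAt I x₀) x) := by
  intro v w hvw
  rw [← mfderivWithin_extChartAt_symm_apply_mfderiv_extChartAt hx v,
    ← mfderivWithin_extChartAt_symm_apply_mfderiv_extChartAt hx w, hvw]

/-- Chain rule in a chart: for `u : ℂ → M` of class `C^n`, `n ≠ 0`, at `z` with `u z` in the chart
domain of `x₀`,
`D(extChartAt I x₀ ∘ u)(z) v = mfderiv (extChartAt I x₀) (u z) (du(z) v)`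
(`HasMFDerivAt.comp`, `mfderiv_eq_fderiv`). [folklore] -/
theorem fderiv_extChartAt_comp_apply {x₀ : M} {u : ℂ → M} {z : ℂ} {n : WithTop ℕ∞}
    (hu : ContMDiffAt 𝓘(ℝ, ℂ) I n u z) (hn : n ≠ 0) (hz : u z ∈ (chartAt H x₀).source) (v : ℂ) :
    fderiv ℝ (fun w : ℂ => extChartAt I x₀ (u w)) z v =
      mfderiv I 𝓘(ℝ, E) (extChartAt I x₀) (u z) (mfderiv 𝓘(ℝ, ℂ) I u z v) := by
  have h := ((mdifferentiableAt_extChartAt (I := I) hz).hasMFDerivAt.comp z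
    ((hu.mdifferentiableAt hn).hasMFDerivAt)).mfderiv
  rw [mfderiv_eq_fderiv] at h
  exact DFunLike.congr_fun h v

/-- The frame expression of an endomorphism field `J` at a point `x` of the chart domain of `x₀`,
applied to a vector: `Jin x v = A (J x (B v))` with `A = mfderiv (extChartAt I x₀) x`,
`B = mfderivWithin (range I) (extChartAt I x₀).symm (extChartAt I x₀ x)`
(`inTangentCoordinates_eq_mfderiv_comp` with `f = g = id`). [folklore] -/
theorem inTangentCoordinates_id_apply (J : ∀ x : M, TangentSpace I x →L[ℝ] TangentSpace I x)
    {x₀ x : M} (hx : x ∈ (chartAt H x₀).source) (v : E) :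
    inTangentCoordinates I I (id : M → M) id (fun x => J x) x₀ x v =
      mfderiv I 𝓘(ℝ, E) (extChartAt I x₀) x
        (J x (mfderivWithin 𝓘(ℝ, E) I (extChartAt I x₀).symm (range I) (extChartAt I x₀ x) v)) := by
  have h := inTangentCoordinates_eq_mfderiv_comp (I := I) (I' := I) (f := (id : M → M))
    (g := (id : M → M)) (ϕ := fun x => J x) (x₀ := x₀) (x := x) hx hx
  exact DFunLike.congr_fun h v

/-! ### From the chart expression back to the curve -/

/-- **Flat holomorphy of the chart expression gives `J`-holomorphy.** If `u : ℂ → M` is `C^n`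
at `z` (`n ≠ 0`), `u z` lies in the chart domain of `x₀`, and the chart expression satisfies
`D(extChartAt I x₀ ∘ u)(z)(iζ) = Jin (u z) (D(extChartAt I x₀ ∘ u)(z) ζ)` for all `ζ`, where
`Jin = inTangentCoordinates I I id id J x₀` is the frame expression of `J`, then
`du(z)(iζ) = J (u z) (du(z) ζ)` for all `ζ`: both sides agree after the injective
`A = mfderiv (extChartAt I x₀) (u z)`, by the chain rule, `Jin (u z) = A ∘ J (u z) ∘ B` and
`B ∘ A = id`. Converse of `jHolomorphic_fderiv_chart`. [folklore] -/
theorem jHolomorphic_of_fderiv_chart (J : ∀ x : M, TangentSpace I x →L[ℝ] TangentSpace I x)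
    {x₀ : M} {u : ℂ → M} {z : ℂ} {n : WithTop ℕ∞} (hu : ContMDiffAt 𝓘(ℝ, ℂ) I n u z) (hn : n ≠ 0)
    (hz : u z ∈ (chartAt H x₀).source)
    (hflat : ∀ ζ : ℂ, fderiv ℝ (fun w : ℂ => extChartAt I x₀ (u w)) z (Complex.I * ζ) =
      inTangentCoordinates I I (id : M → M) id (fun x => J x) x₀ (u z)
        (fderiv ℝ (fun w : ℂ => extChartAt I x₀ (u w)) z ζ)) (ζ : ℂ) :
    mfderiv 𝓘(ℝ, ℂ) I u z (Complex.I * ζ : ℂ) = J (u z) (mfderiv 𝓘(ℝ, ℂ) I u z (ζ : ℂ)) := by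
  have h := hflat ζ
  rw [fderiv_extChartAt_comp_apply hu hn hz, fderiv_extChartAt_comp_apply hu hn hz,
    inTangentCoordinates_id_apply J hz,
    mfderivWithin_extChartAt_symm_apply_mfderiv_extChartAt hz] at h
  exact mfderiv_extChartAt_injective hz h

/-- A curve which is `C^n` everywhere (`n ≠ 0`) and whose chart expressions are flat-holomorphic
for the frame expressions of `J` at every point is `J`-holomorphic (`IsJHolomorphic`). [folklore] -/
theorem isJHolomorphic_of_fderiv_chart (J : ∀ x : M, TangentSpace I x →L[ℝ] TangentSpace I x)
    {u : ℂ → M} {n : WithTop ℕ∞} (hu : ContMDiff 𝓘(ℝ, ℂ) I n u) (hn : n ≠ 0)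
    (hflat : ∀ z ζ : ℂ, fderiv ℝ (fun w : ℂ => extChartAt I (u z) (u w)) z (Complex.I * ζ) =
      inTangentCoordinates I I (id : M → M) id (fun x => J x) (u z) (u z)
        (fderiv ℝ (fun w : ℂ => extChartAt I (u z) (u w)) z ζ)) :
    IsJHolomorphic I J u :=
  fun z ζ => jHolomorphic_of_fderiv_chart J (hu z) hn (mem_chart_source H (u z)) (hflat z) ζ

/-- **Smoothness transfers from the chart expression.** If `u : ℂ → M` is continuous at `z`,
`u z` lies in the chart domain of `x₀` and `extChartAt I x₀ ∘ u` is `C^∞` at `z`, then `u` is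
`C^∞` at `z` (`contMDiffAt_iff_target_of_mem_source`, `contMDiffAt_iff_contDiffAt`). [folklore] -/
theorem contMDiffAt_of_extChartAt_comp {x₀ : M} {u : ℂ → M} {z : ℂ}
    (hcont : ContinuousAt u z) (hz : u z ∈ (chartAt H x₀).source)
    (hdiff : ContDiffAt ℝ ∞ (fun w : ℂ => extChartAt I x₀ (u w)) z) :
    ContMDiffAt 𝓘(ℝ, ℂ) I ∞ u z :=
  (contMDiffAt_iff_target_of_mem_source hz).2 ⟨hcont, contMDiffAt_iff_contDiffAt.2 hdiff⟩

end Literature.Geometry.Symplectic
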